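import Summits.CriticalPhenomena.Ising3DConformalLimit.Theses.HyperoctahedralRP
import Summits.CriticalPhenomena.Ising3DConformalLimit.Theses.IsingEuclidUpgrade
import Summits.CriticalPhenomena.Ising3DConformalLimit.Theses.WeylWindow
import Summits.CriticalPhenomena.Ising3DConformalLimit.Theses.AnomalousForcesInteraction
import Summits.CriticalPhenomena.Ising3DConformalLimit.Theses.LatticeSDPCertificates
import Literature.Probability.LatticeModels.PointwiseScalingLimitScaleCovariant
import Literature.Probability.LatticeModels.CriticalTwoPointDCPLowerHolds
import Literature.Probability.LatticeModels.HighDimPointwiseTriviality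
import Literature.Probability.LatticeModels.GeneralisedFreeFamily
import Literature.Probability.LatticeModels.CriticalUrsellFourSign
import Literature.Probability.LatticeModels.SourcedDoubleCurrentsSwitching
import Literature.Probability.LatticeModels.IntersectionSecondMoment
import Literature.Probability.LatticeModels.SusceptibilityMeanFieldBound
import HarnessLib

/-!
# Line `free-covariance-delta-dichotomy` for crux `IsingEuclidUpgradeR4NonGaussian`
(item stmt-CriticalPhenomena-0636) — CHECKED SKELETON (crux-plan, round 1)

Idea card: `Cruxes/IsingEuclidUpgradeR4NonGaussian/Ideas/free-covariance-delta-dichotomy.md`;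
line card: `Cruxes/IsingEuclidUpgradeR4NonGaussian/Lines/free-covariance-delta-dichotomy.md`.

The crux (every non-degenerate pointwise scaling limit `S` of the critical Ising₃ correlators,
`HasPointwiseScalingLimit (criticalCorr 3) ρ S`, `ρ > 0` on `(0,1]`, has `U₄ ≢ 0`) is attacked through
LAMPERTI'S LEVER: the crux's own hypothesis makes the spin dimension a NUMBER. A full-filter limit with
`S₂ > 0` forces `ρ` to be regularly varying of some index `-Δ` along `δ → 0⁺` and `S` to be scale
covariant with dimension `Δ` on non-coincident configurations (`stub_lamperti`; 80 % of it is the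
tree theorem `HasPointwiseScalingLimit.exists_rpow_scale_mem_Icc`, which also gives `Δ ∈ [1/2,1]`);
the lattice exponent `η` then EXISTS in the logarithmic sense with `η = 2Δ - 1` (`stub_etaExists`),
so Duminil-Copin–Panis 2025 Thm 1.5 (`dcp_isingEta_le_half_holds`, proved in tree) pins
`Δ ∈ [1/2, 3/4]`. The crux then splits at the marginal exponent (triage r1-3 sharpening of the
card's `Δ = 1/2 ∨ Δ > 1/2` split, which is kept as the alternative composition `of_meanFieldBranch`):

* `Δ ∈ [1/2, 3/4)` — `stub_currentBranch`: the random-current engine of the SIBLING line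
  `four-current-coset-robustness` (fat step = four-current intersection, Δ-uniform below `3/4` and
  provable from the free regular variation; thin step = meeting robustness MR, the open heart);
* `Δ = 3/4` — `stub_marginalExclusion`: no Gaussian limit sits at the marginal exponent; stated in
  its weakest form (normalised, translation-invariant, continuous, scale-covariant `3/4`, index
  `-3/4`) and PROVED below to follow from either existing item stmt-CriticalPhenomena-2601
  (`AnomalousForcesInteraction.GaussianLimitIsFree`, Markov rigidity: Gaussian ⇒ `Δ = 1/2`) or
  stmt-CriticalPhenomena-5507 (`LatticeSDPCertificates.WindowBelowHalf`, `η_eff < 1/2` between scales);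
* the glue that feeds those engines their all-configuration hypotheses is the existing item
  stmt-CriticalPhenomena-4739 (`WeylWindow.LimitNormalisation`, provable now: `S ↦ S·𝟙_{NC}` is again a
  limit, translation invariant and continuous on `NonCoincident`) — a REGISTERED OBLIGATION, taken by name
  as the one hypothesis `hN` of the composition (prove it on item 4739, not here).

`lean check`: sorries ONLY inside the four `stub_*`; the registered composition
`IsingEuclidUpgradeR4NonGaussian_of (hN : WeylWindow.LimitNormalisation)` concludes literally
`Summit.CriticalPhenomena.Ising3DConformalLimit.Theses.HyperoctahedralRP.IsingEuclidUpgradeR4NonGaussian`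
(primary route of the payload; the `IsingEuclidUpgrade` copy is the same `Prop`, `crux_iff_isingEuclidUpgrade`)
by applying the sorry-free implication `crux_of_statements : Lamperti → EtaExists → LimitNormalisation →
CurrentBranch → MarginalExclusion → Crux` to the stubs.

Disproof.lean (cdisprove gen 2, NOT REFUTED) honoured: §A.1 `false_without_nondegeneracy` — `S₂ > 0`
is used at `stub_lamperti` (the scale function) and in both branches; §A.2 `false_without_latticeClause`
— both branch engines are lattice statements about `criticalCorr 3` (currents; Markov property), the
GFF witness of `GeneralisedFreeFamily` is not a limit of `criticalCorr 3` under either; §A.3 — `ρ > 0`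
only divides; §B.5 Wick dichotomy — the marginal branch is exactly "Gaussian ⇒ contradiction"; §C —
the current branch ends in `LatticeU4RatioPositive`-type positivity (sibling line); §D — the `d = 3`
input is the power count `3 - 4Δ > 0` below `3/4` and DCP Thm 1.5 at `3/4`; §E.1 not used.
-/

noncomputable section

namespace Summit.CriticalPhenomena.Ising3DConformalLimit.Cruxes.IsingEuclidUpgradeR4NonGaussian.FreeCovarianceDeltaDichotomy

open Literature.Probability.LatticeModels Filter Set
open scoped Topology

/-! ### §0. Vocabulary (bodies only; no axioms, no sorries) -/

/-- The crux, by name (primary route `HyperoctahedralRP`). -/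
abbrev Crux : Prop :=
  Summit.CriticalPhenomena.Ising3DConformalLimit.Theses.HyperoctahedralRP.IsingEuclidUpgradeR4NonGaussian

/-- The two route copies of the shared item are the same proposition. -/
theorem crux_iff_isingEuclidUpgrade :
    Crux ↔ Summit.CriticalPhenomena.Ising3DConformalLimit.Theses.IsingEuclidUpgrade.IsingEuclidUpgradeR4NonGaussian :=
  Iff.rfl

/-- `ρ` is REGULARLY VARYING OF INDEX `-Δ` along the mesh filter: `ρ(cδ)/ρ(δ) → c^{-Δ}` as
`δ → 0⁺`, for every fixed `c > 0` (Lamperti's normalising-constant lemma, transplanted). -/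
def HasIndex (ρ : ℝ → ℝ) (Δ : ℝ) : Prop :=
  ∀ c : ℝ, 0 < c → Tendsto (fun δ => ρ (c * δ) / ρ δ) (𝓝[>] (0:ℝ)) (𝓝 (c ^ (-Δ)))

/-- The crux's hypotheses on `(ρ, S)` together with an index `Δ` for `ρ`. -/
def IsLimitWithIndex (ρ : ℝ → ℝ) (S : CorrFamily 3) (Δ : ℝ) : Prop :=
  (∀ δ ∈ Set.Ioc (0:ℝ) 1, 0 < ρ δ) ∧ HasPointwiseScalingLimit (criticalCorr 3) ρ S ∧
    IsNondegenerateTwoPoint S ∧ HasIndex ρ Δ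

/-- Scale covariance with exponent `Δ` on NON-COINCIDENT configurations (VERBATIM the sibling line's
`FourCurrentCosetRobustness.ScaleCovariantOn` and the output of the tree's
`HasPointwiseScalingLimit.exists_rpow_scale_mem_Icc`; for a normalised family it is `IsScaleCovariant Δ`,
`isScaleCovariant_of_normalised`). -/
def ScaleCovariantOn (Δ : ℝ) (S : CorrFamily 3) : Prop :=
  ∀ (n : ℕ) (c : ℝ), 0 < c → ∀ x ∈ NonCoincident 3 n,
    S n (fun i => c • x i) = c ^ (-(n : ℝ) * Δ) * S n x

/-- **Registered bookkeeping stub `stub_vocabulary`** (carries the line's `Defs` vocabulary file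
`Theorems/IsingEuclidUpgradeR4NonGaussianDefs.lean` through `--supports`): scale covariance on
non-coincident configurations solved for `S n x`: `S n x = c^{nΔ} S n (c • x)`. [folklore] -/
theorem stub_vocabulary :
    ∀ (Δ : ℝ) (S : CorrFamily 3), ScaleCovariantOn Δ S → ∀ (c : ℝ), 0 < c →
      ∀ (n : ℕ), ∀ x ∈ NonCoincident 3 n, S n x = c ^ ((n : ℝ) * Δ) * S n (fun i => c • x i) := by
  intro Δ S h c hc n x hx
  rw [h n c hc x hx, ← mul_assoc, ← Real.rpow_add hc, show (n:ℝ) * Δ + -(n:ℝ) * Δ = 0 by ring,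
    Real.rpow_zero, one_mul]

/-! ### §1. The intermediate statements of the line -/

/-- **Lamperti** (card's `FreeScaleCovariance`): a non-degenerate pointwise scaling limit of
`criticalCorr 3` (`ρ > 0` on `(0,1]`) has a scaling dimension `Δ ∈ [1/2, 1]` such that `ρ` is
regularly varying of index `-Δ` AND `S n (c·x) = c^{-nΔ} S n x` on non-coincident configurations.
(Window + covariance = tree `exists_rpow_scale_mem_Icc`; the ratio limit from
`latticeApprox (cδ) x = latticeApprox δ (c⁻¹x)` and the two convergences at `x`, `c⁻¹x`.) -/
def Lamperti : Prop :=
  ∀ (ρ : ℝ → ℝ) (S : CorrFamily 3), (∀ δ ∈ Set.Ioc (0:ℝ) 1, 0 < ρ δ) →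
    HasPointwiseScalingLimit (criticalCorr 3) ρ S → IsNondegenerateTwoPoint S →
    ∃ Δ : ℝ, 1/2 ≤ Δ ∧ Δ ≤ 1 ∧ HasIndex ρ Δ ∧ ScaleCovariantOn Δ S

/-- **EtaExists**: under the crux hypotheses with index `Δ`, the critical exponent `η` of `ℤ³` EXISTS
in the logarithmic sense and equals `2Δ - 1`: `log ⟨σ₀σ_y⟩_{β_c} / log ‖y‖ → -2Δ`
(`HasIsingExponentEta 3 (2Δ-1)`, the hypothesis of Duminil-Copin–Panis 2025 Thm 1.5). -/
def EtaExists : Prop :=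
  ∀ (ρ : ℝ → ℝ) (S : CorrFamily 3) (Δ : ℝ), IsLimitWithIndex ρ S Δ →
    HasIsingExponentEta 3 (2 * Δ - 1)

/-- **CurrentBranch** (the SIBLING line `four-current-coset-robustness`, run on its natural domain):
a non-degenerate pointwise limit of `criticalCorr 3` whose renormalisation has index `-Δ` with
`1/2 ≤ Δ < 3/4` has `U₄ ≢ 0`. Engine: fat step (four-current intersection `≥ c`, `(EN)²/EN² ≍
L^{3-4Δ}ℓ(L)²/B(L) ≥ c` by Karamata on the free regular variation) + thin step MR (meeting
robustness under the switching-coset thinning) + `−U₄^{lat} = 2⟨σσ⟩⟨σσ⟩·P₂` ⇒ Disproof §C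
`LatticeU4RatioPositive` ⇒ `HasNontrivialU4`. With the covariance clause among the hypotheses this is
LITERALLY the sibling skeleton's kernel-checked `FourCurrentCosetRobustness.hasNontrivialU4_of_exponent_lt`
(modulo its three stubs), plus the unused extras `HasIndex`, `1/2 ≤ Δ`. -/
def CurrentBranch : Prop :=
  ∀ (ρ : ℝ → ℝ) (S : CorrFamily 3) (Δ : ℝ), IsLimitWithIndex ρ S Δ → ScaleCovariantOn Δ S →
    1/2 ≤ Δ → Δ < 3/4 → HasNontrivialU4 S

/-- **MarginalExclusion** (the marginal branch `Δ = 3/4`, weakest form): a NORMALISED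
(`S = 0` off `NonCoincident`), translation-invariant, scale-covariant (`Δ = 3/4`), continuous-on-`NC`
non-degenerate pointwise limit of `criticalCorr 3` whose renormalisation has index `-3/4` has
`U₄ ≢ 0`. Implied by item stmt-2601 `GaussianLimitIsFree` (`marginalExclusion_of_gaussianLimitIsFree`)
and by item stmt-5507 `WindowBelowHalf` (`marginalExclusion_of_windowBelowHalf`). -/
def MarginalExclusion : Prop :=
  ∀ (ρ : ℝ → ℝ) (S : CorrFamily 3), IsLimitWithIndex ρ S (3/4) →
    (∀ n z, z ∉ NonCoincident 3 n → S n z = 0) → IsTranslationInvariant S →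
    IsScaleCovariant (3/4) S → (∀ n, ContinuousOn (S n) (NonCoincident 3 n)) → HasNontrivialU4 S

/-- **MeanFieldBranch** (the card's ORIGINAL `Δ = 1/2` branch; not a registered stub — it is consumed
only by the alternative composition `of_meanFieldBranch`): a non-degenerate pointwise limit whose
renormalisation has index `-1/2` (`η = 0` in the regular-variation sense) has `U₄ ≢ 0`. In the
expected world (`Δ_σ ≈ 0.518`) this is vacuous; its engine is the current engine at `η = 0` or a proof
of `η_rv > 0` (Disproof §E.2: for OS-positive rotation-invariant limits JSP makes the branch empty). -/
def MeanFieldBranch : Prop :=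
  ∀ (ρ : ℝ → ℝ) (S : CorrFamily 3), IsLimitWithIndex ρ S (1/2) → ScaleCovariantOn (1/2) S →
    HasNontrivialU4 S

/-! ### §2. Registered stubs -/

/-- **stub_lamperti** — Lamperti's lever. PROOF ROUTE: `Δ`, the window and the covariance clause are
`HasPointwiseScalingLimit.exists_rpow_scale_mem_Icc hρ hlim hnd` verbatim; for the index, fix the
reference pair `x₀ = (0,e₀)` and `c > 0`: `latticeApprox (c*δ) (x₀ i) = latticeApprox δ (c⁻¹ • x₀ i)`
(`latticeApprox_smul` with `c * δ = c * δ`, `x₀ = c • (c⁻¹ • x₀)`), so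
`ρ(cδ)² ⟨σσ⟩([x₀/(cδ)]) → S₂ x₀` (convergence at `x₀` composed with `δ ↦ cδ`, which maps `𝓝[>]0` to
itself) while `ρ(δ)² ⟨σσ⟩([c⁻¹x₀/δ]) → S₂(c⁻¹x₀) = c^{2Δ} S₂ x₀` (covariance clause); the lattice
factors are the SAME number, hence `(ρ(cδ)/ρ(δ))² → c^{-2Δ}`, and both `ρ(cδ), ρ(δ) > 0` for
`δ < min 1 c⁻¹`, so `ρ(cδ)/ρ(δ) = sqrt(..) → c^{-Δ}` (`Real.sqrt`/`Tendsto.sqrt`, `Real.sqrt_sq`,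
`Real.rpow_natCast`/`rpow_mul`). [size M; provable now; leans on:
`HasPointwiseScalingLimit.exists_rpow_scale_mem_Icc`, `latticeApprox_smul`,
`TendstoLocallyUniformlyOn.tendsto_at`, `refPair_mem_nonCoincident`, `smul_mem_nonCoincident`] -/
theorem stub_lamperti :
    ∀ (ρ : ℝ → ℝ) (S : CorrFamily 3), (∀ δ ∈ Set.Ioc (0:ℝ) 1, 0 < ρ δ) →
      HasPointwiseScalingLimit (criticalCorr 3) ρ S → IsNondegenerateTwoPoint S →
      ∃ Δ : ℝ, 1/2 ≤ Δ ∧ Δ ≤ 1 ∧ HasIndex ρ Δ ∧ ScaleCovariantOn Δ S := by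
  sorry

/-- **stub_etaExists** — the limit makes `η` exist. PROOF ROUTE (no continuity of `S` needed):
(1) axis sequence `g m := criticalTwoPoint 3 (m·e₁)`: from the convergence at the pairs `(0, e₁)` and
`(0, 2e₁)` at mesh `δ = 1/m` (`latticeApprox (1/m) (k•e₁) = (k m)·e₁` exactly) and the index,
`g(2m)/g(m) → 2^{-2Δ}`; (2) MMS axis monotonicity (`messager_miracleSole_holds` /
`twoPointFree_le_axis_of_mem_sphere_holds` + `twoPointPlus_criticalBeta_eq_twoPointFree_holds`) makes
`g` antitone, so `log g(m) = log g(2^k m₀) + O(1)` for `2^k m₀ ≤ m ≤ 2^{k+1} m₀` and Cesàro on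
`log g(2^{k+1}m₀) - log g(2^k m₀) → -2Δ log 2` gives `log g(m)/log m → -2Δ`; (3) all directions:
MMS `g(‖y‖₁) ≤ ⟨σ₀σ_y⟩ ≤ g(⌊‖y‖_∞... /3⌋)`-type sandwiches (`‖y‖₁ ≤ 3‖y‖_∞`) put `log ⟨σ₀σ_y⟩` within
`O(1) + o(log ‖y‖)` of `-2Δ log ‖y‖`; conclude `HasSpatialDecayExponent (criticalTwoPoint 3) (1 + (2Δ-1))`
along `cofinite` (finite balls, `tendsto_cofinite`-style bookkeeping as in
`IsPowerBounded.hasSpatialDecayExponent`). [size M; provable now; leans on: MMS facts above,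
`criticalCorr_two`, `Filter.Tendsto.cesaro`-type averaging, `Real.log_rpow`] -/
theorem stub_etaExists :
    ∀ (ρ : ℝ → ℝ) (S : CorrFamily 3) (Δ : ℝ), IsLimitWithIndex ρ S Δ →
      HasIsingExponentEta 3 (2 * Δ - 1) := by
  sorry


/-! ### §2b. RESHAPE (line lead, 2026-08-16): `stub_currentBranch` replaced by the SIBLING line's three
registered stubs (`four-current-coset-robustness`, whose kernel-checked `hasNontrivialU4_of_exponent_lt` IS
`CurrentBranch` modulo its stubs). Objects, stubs and glue below are copied VERBATIM from
`Cruxes/IsingEuclidUpgradeR4NonGaussian/Lines/four-current-coset-robustness.lean`; `ScaleCovariantOn` is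
the definition of §0 above (identical text). Total registered stubs of this skeleton: 5
(`stub_lamperti`, `stub_etaExists`, `stub_secondMomentBox`, `stub_momentRatioLowerBound`,
`stub_meetingRobustness`, `stub_marginalExclusion` = 6 with the marginal branch). -/

section CurrentBranchReshaped

open Function MeasureTheory Finset Literature.Probability.Percolation
open scoped symmDiff

/-! ## Objects of the line (all finite-volume: the free box `Λ_L ⊂ ℤ³` at `β_c(3)`) -/

/-- The lattice point `x̃ᵢ = [xᵢ/δ]` of a macroscopic configuration `x`. [folklore] -/
abbrev lat (δ : ℝ) (x : Fin 4 → EuclideanSpace ℝ (Fin 3)) (i : Fin 4) : Site 3 :=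
  latticeApprox δ (x i)

/-- The free-boundary box two-point function `G_L(u,v) = ⟨σ_uσ_v⟩⁰_{Λ_L,β_c(3)}`. [folklore] -/
def boxG (L : ℕ) (u v : Site 3) : ℝ :=
  isingTwoPoint (zdGraph 3) (box 3 L) (criticalBeta 3) 0 .free u v

/-- `P² = P^{{a}∆{b},{c}∆{e}}_{Λ_L,β_c}[a ↔ c]`: the probability that the clusters of the two sourced
currents `n₁` (`∂n₁ = {a,b}`) and `n₂` (`∂n₂ = {c,e}`) are glued (`a ↔ c` in `n₁ + n₂`) — the
quantity of the box identity `U₄,Λ_L(a,b,c,e) = −2 G_L(a,b) G_L(c,e) · P²`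
(`connectedFour_free_box_eq`). [cite: AizenmanDuminilCopinAnnals2021, eq. (3.11)] -/
def twoCurrentMeet (L : ℕ) (a b c e : Site 3) : ℝ :=
  (sourcedDoubleCurrentLaw 3 L (criticalBeta 3) ({a} ∆ {b}) ({c} ∆ {e})).real (openConn a c)

/-- The FOUR-CURRENT law `P^{ab,∅}_{Λ_L} ⊗ P^{ce,∅}_{Λ_L}` of `((n₁,n₃),(n₂,n₄))`: two independent
sourced double currents of the free box graph, pairing `(n₁,n₃)`, `(n₂,n₄)` as in ADC21 (3.13).
[cite: AizenmanDuminilCopinAnnals2021, §3.2 eq. (3.13)] -/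
def fourCurrentLaw (L : ℕ) (a b c e : Site 3) :
    Measure ((Current (freeBoxGraph 3 L) × Current (freeBoxGraph 3 L)) ×
      (Current (freeBoxGraph 3 L) × Current (freeBoxGraph 3 L))) :=
  (doubleCurrentMeasure (freeBoxGraph 3 L) (criticalBeta 3) (boxSources 3 L ({a} ∆ {b})) ∅).prod
    (doubleCurrentMeasure (freeBoxGraph 3 L) (criticalBeta 3) (boxSources 3 L ({c} ∆ {e})) ∅)

/-- `MEET₄`: `a ↔ c` in the (lifted) trace of `n₁ + n₃ + n₂ + n₄` — the two fat clusters
`C_{n₁+n₃}(a)`, `C_{n₂+n₄}(c)` are glued (triage r1-3: conditioning on connection in the sum of all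
four currents, which contains `{a ↔ c in n₁+n₂}`). [cite: AizenmanDuminilCopinAnnals2021, §4.2, proof of Lemma 4.4] -/
def FourMeet (L : ℕ) (a c : Site 3) :
    Set ((Current (freeBoxGraph 3 L) × Current (freeBoxGraph 3 L)) ×
      (Current (freeBoxGraph 3 L) × Current (freeBoxGraph 3 L))) :=
  {pq | liftBonds 3 L ((pq.1.1 + pq.1.2) + (pq.2.1 + pq.2.2)).traced ∈ openConn a c}

/-- `P⁴ = P^{ab,∅}_{Λ_L} ⊗ P^{ce,∅}_{Λ_L}[MEET₄]`, the four-current gluing probability. [cite: AizenmanDuminilCopinAnnals2021, §4.2, Lemma 4.4] -/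
def fourCurrentMeet (L : ℕ) (a b c e : Site 3) : ℝ :=
  (fourCurrentLaw L a b c e).real (FourMeet L a c)

/-- The exact one-point density of a sourced double current (switching):
`P^{ab,∅}_{Λ_L}[v ∈ C_{n₁+n₃}(a)] = G_L(a,v)G_L(v,b)/G_L(a,b)`. [cite: AizenmanDuminilCopinAnnals2021, §4.2, proof of Lemma 4.4 (first display)] -/
def threePointRatio (L : ℕ) (a b v : Site 3) : ℝ :=
  boxG L a v * boxG L v b / boxG L a b

/-- FIRST MOMENT `M₁ = E⁴[N_A]` of the number `N_A` of sites of `A` in `C_{n₁+n₃}(a) ∩ C_{n₂+n₄}(c)`: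
`∑_{v ∈ A} (G(a,v)G(v,b)/G(a,b)) · (G(c,v)G(v,e)/G(c,e))`. [cite: AizenmanDuminilCopinAnnals2021, §4.2, proof of Lemma 4.4] -/
def boxMoment₁ (L : ℕ) (a b c e : Site 3) (A : Finset (Site 3)) : ℝ :=
  ∑ v ∈ A, threePointRatio L a b v * threePointRatio L c e v

/-- The two-step (tree) bound of ADC21 Prop. A.3 for a pair of sites:
`B_{ab}(v,w) = G(a,v)G(v,w)G(w,b) + G(a,w)G(w,v)G(v,b)`. [cite: AizenmanDuminilCopinAnnals2021, Appendix A.2, Proposition A.3] -/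
def twoStep (L : ℕ) (a b v w : Site 3) : ℝ :=
  boxG L a v * boxG L v w * boxG L w b + boxG L a w * boxG L w v * boxG L v b

/-- SECOND-MOMENT BOUND `M₂ ≥ E⁴[N_A²]`:
`∑_{v,w ∈ A} (B_{ab}(v,w)/G(a,b)) · (B_{ce}(v,w)/G(c,e))`. [cite: AizenmanDuminilCopinAnnals2021, §4.2, proof of Lemma 4.4 (second display)] -/
def boxMoment₂ (L : ℕ) (a b c e : Site 3) (A : Finset (Site 3)) : ℝ :=
  ∑ v ∈ A, ∑ w ∈ A, (twoStep L a b v w / boxG L a b) * (twoStep L c e v w / boxG L c e)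

/-- The lattice connected four-point function at the mesh-`δ` approximation of `x` (VERBATIM the
Disproof's `latU4`, restated so that this file does not import the living workfile). [folklore] -/
def latU4 (δ : ℝ) (x : Fin 4 → EuclideanSpace ℝ (Fin 3)) : ℝ :=
  criticalCorr 3 4 (fun i => latticeApprox δ (x i)) -
    (criticalCorr 3 2 ![latticeApprox δ (x 0), latticeApprox δ (x 1)] *
        criticalCorr 3 2 ![latticeApprox δ (x 2), latticeApprox δ (x 3)]
      + criticalCorr 3 2 ![latticeApprox δ (x 0), latticeApprox δ (x 2)] *
        criticalCorr 3 2 ![latticeApprox δ (x 1), latticeApprox δ (x 3)]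
      + criticalCorr 3 2 ![latticeApprox δ (x 0), latticeApprox δ (x 3)] *
        criticalCorr 3 2 ![latticeApprox δ (x 1), latticeApprox δ (x 2)])

/-- **The Disproof's ρ-free LATTICE TARGET (§C, VERBATIM)**: at some non-coincident quadruple `x` and
some `c > 0`, `-U₄^{lat}([x/δ]) ≥ c·⟨σ_{[x₀/δ]}σ_{[x₁/δ]}⟩⟨σ_{[x₂/δ]}σ_{[x₃/δ]}⟩` for all small `δ > 0`
— "the double-current intersection probability at scale `1/δ` stays bounded below" (ADC21 (3.11)).
`Iff.rfl` with `Disproof.LatticeU4RatioPositive`. [cite: AizenmanDuminilCopinAnnals2021, eq. (3.11)] -/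
def LatticeU4RatioPositive : Prop :=
  ∃ x ∈ NonCoincident 3 4, ∃ c : ℝ, 0 < c ∧ ∀ᶠ δ in 𝓝[>] (0:ℝ),
    c * (criticalCorr 3 2 ![latticeApprox δ (x 0), latticeApprox δ (x 1)] *
      criticalCorr 3 2 ![latticeApprox δ (x 2), latticeApprox δ (x 3)]) ≤ - latU4 δ x


/-! ## The registered stubs -/

/-- **STUB 1 — FAT STEP, combinatorial half: the second-moment inequality for two independent
sourced double currents with DISJOINT source pairs in a box (provable now, size M).** For
`a,b,c,e ∈ Λ_L`, `A ⊆ Λ_L`: `P⁴[a ↔ c in n₁+n₃+n₂+n₄] ≥ M₁²/M₂`. Proof = the three displays of ADC21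
Lemma 4.4 with `{o,x},{o,z}` replaced by `{a,b},{c,e}`: (i) `E⁴[N_A] = M₁` — the one-point density
`P^{ab,∅}[v ∈ C_{n₁+n₃}(a)] = G(a,v)G(v,b)/G(a,b)` is EXACT (switching; tree
`tsum_epairWeight_mul_indicator_mem_cluster`), independence of the two pairs; (ii) `E⁴[N_A²] ≤ M₂` —
`P^{ab,∅}[v,w ∈ C_{n₁+n₃}(a)] ≤ B_{ab}(v,w)/G(a,b)` (ADC21 Prop. A.3; tree
`ecurrentSum_empty_mul_tsum_connInd_mul_connInd_le`); (iii) Cauchy–Schwarz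
`P[N ≠ 0] ≥ E[N]²/E[N²]` (tree `Current.tsum_mul_sq_le_tsum_indicator_mul_tsum_sq`), and
`{N_A ≠ 0} ⊆ MEET₄` (a common site of `C_{n₁+n₃}(a)` and `C_{n₂+n₄}(c)` joins `a` to `c` in the union
of the traces; lift with `liftBonds_mem_openConn_iff`). Remaining formal work: the tree's
`IntersectionSecondMoment` is stated for a SHARED source `o` and in un-normalised `ℝ≥0∞` current-sum
form (`ecurrentSum`); transport to `doubleCurrentMeasure`/`isingTwoPoint` of the box via
`isingTwoPoint_free_eq_currentSum_div`, `isingTwoPoint_free_box_eq_boxGraph` (triage r1-1: "the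
disjoint-source variant is the same proof, not yet in tree"). With Lean's `x/0 = 0` the inequality is
trivially true in every degenerate case. [cite: AizenmanDuminilCopinAnnals2021, §4.2 Lemma 4.4 and Appendix A Prop. A.3] -/
theorem stub_secondMomentBox :
    ∀ (L : ℕ) (a b c e : Site 3), a ∈ box 3 L → b ∈ box 3 L → c ∈ box 3 L → e ∈ box 3 L →
      ∀ A : Finset (Site 3), A ⊆ box 3 L →
        boxMoment₁ L a b c e A ^ 2 / boxMoment₂ L a b c e A ≤ fourCurrentMeet L a b c e := by
  sorry

/-- **STUB 2 — FAT STEP, analytic half: below `Δ = 3/4` the moment ratio does not degenerate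
(provable now, size M–L; the `d = 3`-specific input of the line).** Under the crux hypotheses, if the
(automatic) scaling exponent satisfies `Δ < 3/4`, then for EVERY non-coincident quadruple `x` there
are `c > 0` and counting regions `A(δ) ⊂ ℤ³` (intended: the lattice ball of radius `R/δ` around the
configuration, `R ≍ diam x`) with `M₁²/M₂ ≥ c` at `x̃ = [x/δ]` for all small `δ` and then all large
`L`. For fixed `δ` every `G_L` term converges as `L → ∞` (`criticalCorr_wellDefined_holds`), so the
content is the `δ → 0` asymptotics of the infinite-volume sums: with `G(x̃ᵢ,v) = ρ(δ)⁻²(S₂(xᵢ,δv) +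
o(1))` uniformly for `δv` at macroscopic distance from the `xᵢ` (the limit hypothesis; this is the
two-sided, all-direction control of `G` at scale `1/δ` that ADC had to manufacture through regular
scales), the Simon–Lieb/infrared window `c‖v‖⁻² ≤ G ≤ C‖v‖⁻¹` near the sources
(`criticalTwoPoint_bounds_holds`) and scale covariance `S₂(cu) = c^{-2Δ}S₂(u)`: `M₁ ≍ δ^{4Δ−3}`,
generic terms of `M₂ ≍ δ^{8Δ−6}`, and the near-diagonal terms `v ≈ w` of `M₂` are
`δ^{4Δ−3} · ∑_{‖w‖ ≤ R/δ} G(w)² · O(1)`; the bubble-at-scale `∑_{‖w‖ ≤ N} G(w)²` is `O(N³G(N)²)`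
iff `3 − 4Δ > 0`. Multi-scale control WITHOUT Karamata theory (ρ need not even be measurable): the
limit at mesh `1/r` gives the RATIO REGULARITY `G(0,[cq·r])/G(0,[q·r]) → c^{-2Δ}` uniformly for `q`
on the unit sphere and `c` in a compact (local uniformity on a compact annulus of `NC₂` + scale
covariance of `S₂`); chained dyadically from scale `N = R/δ` down to a fixed `r₀` it yields the
Potter-type bound `G(r) ≤ G(N)(r/N)^{-2Δ-ε}` for `r₀ ≤ r ≤ N` with an `ε`-loss per the compounding —
affordable because `3 − 4Δ > 0` is an OPEN condition (bubble `≤ N³G(N)²/(3−4Δ−2ε)`; near-source shells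
`∑_{r ≤ εN} r²G(r) ≤ ε^{3−2Δ−ε'}·N³G(N)`); sites at bounded distance `≤ r₀` from a source carry
`G ≤ 1` and contribute `O(ρ(δ)⁻²) = o(M₁²·δ⁶ρ⁸)` since `Δ < 1`. Whence `M₁²/M₂ ≥ c`. Why it might
fail: only through the uniformity of the ratio regularity in the direction — which local uniform
convergence on the compact annulus supplies. At `Δ = 3/4` the bubble is `∑ 1/r = log N` and the
ratio decays like `1/log(1/δ)` (ADC's marginal case): the threshold is sharp. [cite: AizenmanDuminilCopinAnnals2021, §4.2 Lemma 4.4, §5 (regular scales) and eq. (1.12)]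
[cite: Aizenman1982, §1 and Prop. 5.3 (tree-diagram count L^{4-d})] -/
theorem stub_momentRatioLowerBound :
    ∀ (ρ : ℝ → ℝ) (S : CorrFamily 3) (Δ : ℝ), (∀ δ ∈ Set.Ioc (0:ℝ) 1, 0 < ρ δ) →
      HasPointwiseScalingLimit (criticalCorr 3) ρ S → IsNondegenerateTwoPoint S →
      ScaleCovariantOn Δ S → Δ < 3 / 4 →
      ∀ x ∈ NonCoincident 3 4, ∃ c : ℝ, 0 < c ∧ ∃ A : ℝ → Finset (Site 3),
        ∀ᶠ δ in 𝓝[>] (0:ℝ), ∀ᶠ L : ℕ in atTop,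
          c ≤ boxMoment₁ L (lat δ x 0) (lat δ x 1) (lat δ x 2) (lat δ x 3) (A δ) ^ 2 /
              boxMoment₂ L (lat δ x 0) (lat δ x 1) (lat δ x 2) (lat δ x 3) (A δ) := by
  sorry

/-- **STUB 3 — THIN STEP = MEETING ROBUSTNESS `MR` (the card's Transfer `C⁺`; OPEN, size XL — the
HARDEST stub, the open heart of the line).** Under the crux hypotheses with `Δ < 3/4` there is ONE
non-coincident quadruple `x` and `c > 0` with `P² ≥ c · P⁴` at `x̃ = [x/δ]` for all small `δ` and large
`L`: conditionally on the two FAT clusters `C_{n₁+n₃}(x̃₀)`, `C_{n₂+n₄}(x̃₂)` being glued, the THIN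
pair still joins `x̃₀` to `x̃₂` in `n₁ + n₂` with probability `≥ c` (`P²` is the `P⁴`-probability of
`{x̃₀ ↔ x̃₂ in n₁+n₂}`: the `(n₁,n₂)`-marginal of `P^{ab,∅} ⊗ P^{ce,∅}` is `P^{ab} ⊗ P^{ce}` =
`doubleCurrentMeasure _ _ {a,b} {c,e}`, read on the trace by `sourcedTrace_preimage_openConn`).
WHY EASIER than the crux (card + triage): (i) the conditional law is EXPLICIT — given `m = n₁+n₃`,
`n₁` is a uniform element of the parity coset `{n ≤ m̃ : ∂n = {x̃₀,x̃₁}}` of the edge-copy multigraph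
(independent fair coins on the copies conditioned on the boundary: the combinatorial core of the
switching lemma, `w(n₁)w(n₃) = w(m)∏ C(m_e, n₁,e)`), independently for `(n₂ | n₂+n₄)`, and by
switching `P^{ab,∅}[· | v ∈ C_{n₁+n₃}(a)]` is the law of the sum of two independent sourced currents
`a → v`, `v → b`; so near a contact site the question is finite `𝔽₂`-linear algebra on the local cycle
space; (ii) pairing involutions give free partial robustness (`P_coins[deg_{n₁}(v) ≥ 2 | m] ≥ 1/2`; a
cut vertex of the multigraph between the `a`- and `b`-sides lies on `C_{n₁}(a)` surely); (iii) two
sufficient conditions of different flavour: `RobustCoreDensity` (≈ the single ≥ c·double one-point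
comparison — probably FALSE as an `O(1)` statement by the card's own `d = 1`/Lupu–Werner toy and
`D_HT ≈ 1.73 < 2 − η`, triage r1-1/3: do NOT start there) and the coin-free `BackboneContact`
`P^{ab} ⊗ P^{ce}[backbone(n₁) ∩ backbone(n₂) ≠ ∅] ≥ c` (a common vertex of the two backbones gives
`a ↔ c in n₁+n₂` outright; second-moment problem for Aizenman's backbone with the chain rule — tree
`BackboneChainRule`, `BackboneKernel`, upper bounds proved — whose missing input is a one-point LOWER
bound through the depleted two-point function; triage r1-2: "the coin-free sufficient condition to
stub first", file it with `--supports`). CALIBRATION (why it might fail): given STUBS 1–2, MR is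
EQUIVALENT to the crux below `Δ = 3/4` (Disproof §C), and it must FAIL in any Wick world with
`η < 1/2` (the fat step uses no interaction) — the Ising interaction (`σ² = 1` ⇒ hard-core parity
constraint) enters ONLY through the coset; at `Δ = 1/2` exactly, MR is vacuous-or-false (an
OS-positive rotation-invariant `η = 0` limit would be free by Jost–Schroer–Pohlmeyer, Disproof §E.2),
so its content lives at `Δ ∈ (1/2, 3/4)` ∋ `Δ_σ ≈ 0.518`, where item 2601 is an ALTERNATIVE engine
(Markov inheritance) that this line does not use; numerically `p = −U₄/(2S₂S₂) = O(1)` at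
macroscopic separation (Disproof §F), i.e. MR holds with `c ≈ p`. The shared open heart of cards 2/4/6
is a lower bound on the meeting of two independent SINGLE sourced critical currents on `ℤ³` (triage
r1-2 cross-card note).
[cite: AizenmanDuminilCopinAnnals2021, Lemma 3.3 (switching) and eq. (3.11)]
[cite: Aizenman1982, §3 Lemma 3.2 and §5] [cite: LupuWerner2016, Thm. 1 (arXiv:1511.05524)] -/
theorem stub_meetingRobustness :
    ∀ (ρ : ℝ → ℝ) (S : CorrFamily 3) (Δ : ℝ), (∀ δ ∈ Set.Ioc (0:ℝ) 1, 0 < ρ δ) →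
      HasPointwiseScalingLimit (criticalCorr 3) ρ S → IsNondegenerateTwoPoint S →
      ScaleCovariantOn Δ S → Δ < 3 / 4 →
      ∃ x ∈ NonCoincident 3 4, ∃ c : ℝ, 0 < c ∧
        ∀ᶠ δ in 𝓝[>] (0:ℝ), ∀ᶠ L : ℕ in atTop,
          c * fourCurrentMeet L (lat δ x 0) (lat δ x 1) (lat δ x 2) (lat δ x 3) ≤
            twoCurrentMeet L (lat δ x 0) (lat δ x 1) (lat δ x 2) (lat δ x 3) := by
  sorry


/-! ## Proved glue -/

/-- Eventually (in `L`) the four lattice points and a given finite set lie in the box `Λ_L`. [folklore] -/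
theorem eventually_mem_box (δ : ℝ) (x : Fin 4 → EuclideanSpace ℝ (Fin 3)) (A : Finset (Site 3)) :
    ∀ᶠ L : ℕ in atTop, (∀ i, lat δ x i ∈ box 3 L) ∧ A ⊆ box 3 L := by
  classical
  obtain ⟨L₀, hL₀⟩ := exists_forall_subset_box 3 (A ∪ Finset.univ.image (lat δ x))
  filter_upwards [eventually_ge_atTop L₀] with L hL
  refine ⟨fun i => hL₀ L hL ?_, fun v hv => hL₀ L hL (Finset.mem_union_left _ hv)⟩
  exact Finset.mem_union_right _ (Finset.mem_image_of_mem _ (Finset.mem_univ i))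

/-- **FAT STEP (STUBS 1 + 2)**: below `Δ = 3/4` the four-current gluing probability at scale `1/δ`
is bounded below, for small `δ` and large `L`, at every non-coincident quadruple.
[cite: AizenmanDuminilCopinAnnals2021, §4.2 Lemma 4.4] -/
theorem fourCurrentMeet_lower {ρ : ℝ → ℝ} {S : CorrFamily 3} {Δ : ℝ}
    (hρ : ∀ δ ∈ Set.Ioc (0:ℝ) 1, 0 < ρ δ) (hlim : HasPointwiseScalingLimit (criticalCorr 3) ρ S)
    (hnd : IsNondegenerateTwoPoint S) (hcov : ScaleCovariantOn Δ S) (hΔ : Δ < 3 / 4)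
    {x : Fin 4 → EuclideanSpace ℝ (Fin 3)} (hx : x ∈ NonCoincident 3 4) :
    ∃ c : ℝ, 0 < c ∧ ∀ᶠ δ in 𝓝[>] (0:ℝ), ∀ᶠ L : ℕ in atTop,
      c ≤ fourCurrentMeet L (lat δ x 0) (lat δ x 1) (lat δ x 2) (lat δ x 3) := by
  obtain ⟨c, hc, A, hev⟩ := stub_momentRatioLowerBound ρ S Δ hρ hlim hnd hcov hΔ x hx
  refine ⟨c, hc, ?_⟩
  filter_upwards [hev] with δ hδ
  filter_upwards [hδ, eventually_mem_box δ x (A δ)] with L hL hbox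
  exact hL.trans (stub_secondMomentBox L _ _ _ _ (hbox.1 0) (hbox.1 1) (hbox.1 2) (hbox.1 3)
    (A δ) hbox.2)

/-- **FAT × THIN (STUBS 1–3)**: below `Δ = 3/4` the double-current gluing probability
`P^{x̃₀x̃₁,x̃₂x̃₃}_{Λ_L}[x̃₀ ↔ x̃₂]` is bounded below at one non-coincident quadruple, for small `δ` and
large `L`. [cite: AizenmanDuminilCopinAnnals2021, eq. (3.11)] -/
theorem twoCurrentMeet_lower {ρ : ℝ → ℝ} {S : CorrFamily 3} {Δ : ℝ}
    (hρ : ∀ δ ∈ Set.Ioc (0:ℝ) 1, 0 < ρ δ) (hlim : HasPointwiseScalingLimit (criticalCorr 3) ρ S)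
    (hnd : IsNondegenerateTwoPoint S) (hcov : ScaleCovariantOn Δ S) (hΔ : Δ < 3 / 4) :
    ∃ x ∈ NonCoincident 3 4, ∃ κ : ℝ, 0 < κ ∧ ∀ᶠ δ in 𝓝[>] (0:ℝ), ∀ᶠ L : ℕ in atTop,
      κ ≤ twoCurrentMeet L (lat δ x 0) (lat δ x 1) (lat δ x 2) (lat δ x 3) := by
  obtain ⟨x, hx, c, hc, hev⟩ := stub_meetingRobustness ρ S Δ hρ hlim hnd hcov hΔ
  obtain ⟨c', hc', hev'⟩ := fourCurrentMeet_lower hρ hlim hnd hcov hΔ hx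
  refine ⟨x, hx, c * c', mul_pos hc hc', ?_⟩
  filter_upwards [hev, hev'] with δ hδ hδ'
  filter_upwards [hδ, hδ'] with L hL hL'
  calc c * c' ≤ c * fourCurrentMeet L (lat δ x 0) (lat δ x 1) (lat δ x 2) (lat δ x 3) :=
        mul_le_mul_of_nonneg_left hL' hc.le
    _ ≤ _ := hL

/-- **From the box lower bound to the Disproof's ρ-free LATTICE TARGET** (`Λ_L ↑ ℤ³` after `δ`):
if `P^{x̃₀x̃₁,x̃₂x̃₃}_{Λ_L}[x̃₀ ↔ x̃₂] ≥ κ > 0` for small `δ` and large `L`, then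
`−U₄^{lat}([x/δ]) ≥ 2κ ⟨σσ⟩⟨σσ⟩([x/δ])` for small `δ` — the box identity `U₄,Λ_L = −2G_LG_L·P²`
(`connectedFour_free_box_eq`), Griffiths I for `G_L ≥ 0`, and the box limits
`tendsto_connectedFour_box_criticalBeta` / `criticalCorr_wellDefined_holds`.
[cite: AizenmanDuminilCopinAnnals2021, eq. (3.11)–(3.12)] -/
theorem latticeU4RatioPositive_of_twoCurrentMeet_lower
    (h : ∃ x ∈ NonCoincident 3 4, ∃ κ : ℝ, 0 < κ ∧ ∀ᶠ δ in 𝓝[>] (0:ℝ), ∀ᶠ L : ℕ in atTop,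
      κ ≤ twoCurrentMeet L (lat δ x 0) (lat δ x 1) (lat δ x 2) (lat δ x 3)) :
    LatticeU4RatioPositive := by
  classical
  obtain ⟨x, hx, κ, hκ, hev⟩ := h
  refine ⟨x, hx, 2 * κ, by positivity, ?_⟩
  filter_upwards [hev] with δ hδ
  -- the lattice configuration at mesh `δ`
  set y : Fin 4 → Site 3 := fun i => latticeApprox δ (x i) with hy
  have hmem : (BoundaryCondition.free : BoundaryCondition (Site 3)) ∈
      ({.free, .plus, .minus} : Set (BoundaryCondition (Site 3))) := by simp
  -- box two-point functions converge to the critical ones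
  have hT : ∀ i j : Fin 4, Tendsto (fun L : ℕ => boxG L (y i) (y j)) atTop
      (𝓝 (criticalCorr 3 2 ![y i, y j])) := by
    intro i j
    have h := criticalCorr_wellDefined_holds (d := 3) (by norm_num) 2 ![y i, y j] .free hmem
    refine Tendsto.congr (fun L => ?_) h
    simp only [boxG, isingTwoPoint, spinMonomial_two]
  -- the box connected four-point function converges to `latU4 δ x`
  have hU : Tendsto (fun L : ℕ => connectedFour (isingMeasure (zdGraph 3) (box 3 L) (criticalBeta 3)
      0 .free) spinAt y) atTop (𝓝 (latU4 δ x)) :=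
    tendsto_connectedFour_box_criticalBeta (d := 3) (by norm_num) y
  have hB := ((hT 0 1).mul (hT 2 3)).const_mul (2 * κ)
  -- the inequality in every large box
  have hle : ∀ᶠ L : ℕ in atTop, 2 * κ * (boxG L (y 0) (y 1) * boxG L (y 2) (y 3)) ≤
      -(connectedFour (isingMeasure (zdGraph 3) (box 3 L) (criticalBeta 3) 0 .free) spinAt y) := by
    filter_upwards [hδ, eventually_mem_box δ x ∅] with L hL hbox
    have hb := hbox.1
    have hy4 : y = ![y 0, y 1, y 2, y 3] := by funext i; fin_cases i <;> rfl
    have hid := connectedFour_free_box_eq 3 L (criticalBeta_nonneg 3) (hb 0) (hb 1) (hb 2) (hb 3)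
    rw [hy4, hid]
    simp only [Matrix.cons_val_zero, Matrix.cons_val_one, Matrix.cons_val]
    have hG01 : 0 ≤ boxG L (y 0) (y 1) := isingTwoPoint_free_nonneg' (criticalBeta_nonneg 3) (hb 0) (hb 1)
    have hG23 : 0 ≤ boxG L (y 2) (y 3) := isingTwoPoint_free_nonneg' (criticalBeta_nonneg 3) (hb 2) (hb 3)
    have hP : κ ≤ twoCurrentMeet L (y 0) (y 1) (y 2) (y 3) := hL
    have hGG : 0 ≤ boxG L (y 0) (y 1) * boxG L (y 2) (y 3) := mul_nonneg hG01 hG23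
    have key := mul_le_mul_of_nonneg_left hP hGG
    unfold twoCurrentMeet at key
    unfold boxG at key hGG ⊢
    nlinarith [key, hGG]
  have hfin := le_of_tendsto_of_tendsto hB hU.neg hle
  -- rewrite the limit inequality in the Disproof's spelling
  have e01 : (![y 0, y 1] : Fin 2 → Site 3) = ![latticeApprox δ (x 0), latticeApprox δ (x 1)] := rfl
  have e23 : (![y 2, y 3] : Fin 2 → Site 3) = ![latticeApprox δ (x 2), latticeApprox δ (x 3)] := rfl
  rw [e01, e23] at hfin
  exact hfin


/-- **The lattice target suffices (the Disproof's §C.1 `of_latticeU4RatioPositive`, proof copied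
verbatim, sorry-free; stated per limit `S` rather than as the named crux so that the skeleton theorem
below is the ONLY theorem concluding the crux decl by name)**: for ANY non-degenerate pointwise limit
`S`, the rescaled lattice inequality passes to the limit (`tendsto_rescaled_criticalUrsellFour`) and
gives `U₄^S(x) ≤ −c S₂(x₀,x₁)S₂(x₂,x₃) < 0`. [cite: AizenmanDuminilCopinAnnals2021, eq. (3.11)] -/
theorem hasNontrivialU4_of_latticeU4RatioPositive (h : LatticeU4RatioPositive) {ρ : ℝ → ℝ}
    {S : CorrFamily 3} (hlim : HasPointwiseScalingLimit (criticalCorr 3) ρ S)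
    (hnd : IsNondegenerateTwoPoint S) : HasNontrivialU4 S := by
  obtain ⟨x, hx, c, hc, hev⟩ := h
  have hinj : Function.Injective x := hx
  have hpair : ∀ i j, i ≠ j → Tendsto
      (fun δ => ρ δ ^ 2 * criticalCorr 3 2 ![latticeApprox δ (x i), latticeApprox δ (x j)])
      (𝓝[>] 0) (𝓝 (S 2 ![x i, x j])) := by
    intro i j hij
    have hmem : (![x i, x j] : Fin 2 → EuclideanSpace ℝ (Fin 3)) ∈ NonCoincident 3 2 :=
      pair_mem_nonCoincident fun h => hij (hinj h)
    refine Tendsto.congr (fun δ => ?_) ((hlim 2).tendsto_at hmem)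
    rw [rescaledCorrelator_apply, latticeApprox_comp_two]
    rfl
  have hU : Tendsto (fun δ => ρ δ ^ 4 * latU4 δ x) (𝓝[>] 0) (𝓝 (limitConnectedFour S x)) :=
    tendsto_rescaled_criticalUrsellFour hlim hx
  have hB := (((hpair 0 1 (by decide)).mul (hpair 2 3 (by decide))).const_mul c)
  have hle : c * (S 2 ![x 0, x 1] * S 2 ![x 2, x 3]) ≤ - limitConnectedFour S x := by
    refine le_of_tendsto_of_tendsto hB hU.neg ?_
    filter_upwards [hev] with δ hδ
    have h4 : (0:ℝ) ≤ ρ δ ^ 4 := by positivity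
    have := mul_le_mul_of_nonneg_left hδ h4
    calc c * (ρ δ ^ 2 * criticalCorr 3 2 ![latticeApprox δ (x 0), latticeApprox δ (x 1)] *
          (ρ δ ^ 2 * criticalCorr 3 2 ![latticeApprox δ (x 2), latticeApprox δ (x 3)]))
        = ρ δ ^ 4 * (c * (criticalCorr 3 2 ![latticeApprox δ (x 0), latticeApprox δ (x 1)] *
          criticalCorr 3 2 ![latticeApprox δ (x 2), latticeApprox δ (x 3)])) := by ring
      _ ≤ ρ δ ^ 4 * (- latU4 δ x) := this
      _ = -(ρ δ ^ 4 * latU4 δ x) := by ring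
  have h01 : (![x 0, x 1] : Fin 2 → _) ∈ NonCoincident 3 2 :=
    pair_mem_nonCoincident fun h => absurd (hinj h) (by decide)
  have h23 : (![x 2, x 3] : Fin 2 → _) ∈ NonCoincident 3 2 :=
    pair_mem_nonCoincident fun h => absurd (hinj h) (by decide)
  have hpos : 0 < c * (S 2 ![x 0, x 1] * S 2 ![x 2, x 3]) :=
    mul_pos hc (mul_pos (hnd _ h01) (hnd _ h23))
  exact ⟨x, hx, by linarith⟩


/-- **MEAN-FIELD CALIBRATION (kernel-checked, items-free modulo STUBS 1–3)**: a non-degenerate limit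
whose exponent is `< 3/4` — in particular any limit with `Δ = 1/2` (`η = 0`) — has `U₄ ≢ 0`. This is
the card's "MeanFieldBranch = four-current at `η = 0`" (triage r1-1 dependency note) and shows where
item 2601 is and is not consumed. [cite: AizenmanDuminilCopinAnnals2021, Lemma 4.4] -/
theorem hasNontrivialU4_of_exponent_lt {ρ : ℝ → ℝ} {S : CorrFamily 3} {Δ : ℝ}
    (hρ : ∀ δ ∈ Set.Ioc (0:ℝ) 1, 0 < ρ δ) (hlim : HasPointwiseScalingLimit (criticalCorr 3) ρ S)
    (hnd : IsNondegenerateTwoPoint S) (hcov : ScaleCovariantOn Δ S) (hΔ : Δ < 3 / 4) :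
    HasNontrivialU4 S :=
  hasNontrivialU4_of_latticeU4RatioPositive
    (latticeU4RatioPositive_of_twoCurrentMeet_lower (twoCurrentMeet_lower hρ hlim hnd hcov hΔ)) hlim hnd


/-- **`CurrentBranch` from the sibling's three stubs** (the reshaped `stub_currentBranch`; the extra
hypotheses `HasIndex`, `1/2 ≤ Δ` are unused gifts). [cite: AizenmanDuminilCopinAnnals2021, Lemma 4.4] -/
theorem currentBranch_of_stubs : CurrentBranch :=
  fun _ _ _ hWI hcov _ hlt => hasNontrivialU4_of_exponent_lt hWI.1 hWI.2.1 hWI.2.2.1 hcov hlt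

end CurrentBranchReshaped


/-- **stub_marginalExclusion** — the marginal branch. Two independent sufficient items, both reductions
kernel-checked below: (a) stmt-2601 `GaussianLimitIsFree` (Newman: `U₄ ≡ 0` ⇒ Gaussian, tree
`CriticalWickDichotomy`; Markov inheritance; Pitt–Kotani–Rozanov: a germ-Markov self-similar Gaussian
field has spectral density `1/P`, `P` a form of degree `3 - 2Δ` ⇒ `Δ = 1/2 ≠ 3/4`);
(b) stmt-5507 `WindowBelowHalf` (`⟨σ₀σ_{ne₁}⟩ ≥ c (n/m)^{-(3/2-ε)} ⟨σ₀σ_{me₁}⟩`: incompatible with index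
`-3/4`, which forces `⟨σ₀σ_{kme₁}⟩/⟨σ₀σ_{me₁}⟩ → k^{-3/2}`). At `Δ = 3/4` exactly no current-based
engine can work (the `d = 3` count degenerates to the `d = 4` marginal one: `(EN)²/EN² ≍ ℓ(L)²/B(L) → 0`,
barrier `IsingTrivialityFromDimensionFour` RESPECTED), which is why this branch is isolated.
[size XL via (a) / open-problem via (b)] -/
theorem stub_marginalExclusion :
    ∀ (ρ : ℝ → ℝ) (S : CorrFamily 3), IsLimitWithIndex ρ S (3/4) →
      (∀ n z, z ∉ NonCoincident 3 n → S n z = 0) → IsTranslationInvariant S →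
      IsScaleCovariant (3/4) S → (∀ n, ContinuousOn (S n) (NonCoincident 3 n)) → HasNontrivialU4 S := by
  sorry

/-! ### §3. Glue lemmas (sorry-free) -/

/-- Two pointwise limits of the same lattice family with the same `ρ` agree on `NonCoincident`
(uniqueness of limits along the non-trivial filter `𝓝[>] 0`). -/
theorem eqOn_of_limits {ρ : ℝ → ℝ} {S S' : CorrFamily 3}
    (hlim : HasPointwiseScalingLimit (criticalCorr 3) ρ S)
    (hlim' : HasPointwiseScalingLimit (criticalCorr 3) ρ S') (n : ℕ) :
    (NonCoincident 3 n).EqOn (S' n) (S n) :=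
  (hlim' n).unique (hlim n)

/-- Pairs extracted from a non-coincident quadruple are non-coincident. -/
theorem pair_mem_of_mem_four {x : Fin 4 → EuclideanSpace ℝ (Fin 3)} (hx : x ∈ NonCoincident 3 4)
    {i j : Fin 4} (hij : i ≠ j) : (![x i, x j] : Fin 2 → EuclideanSpace ℝ (Fin 3)) ∈ NonCoincident 3 2 := by
  have hinj : Function.Injective x := hx
  exact pair_mem_nonCoincident fun h => hij (hinj h)

/-- `U₄` only reads `S` on non-coincident configurations. -/
theorem limitConnectedFour_congr {S S' : CorrFamily 3}
    (h2 : (NonCoincident 3 2).EqOn (S' 2) (S 2)) (h4 : (NonCoincident 3 4).EqOn (S' 4) (S 4))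
    {x : Fin 4 → EuclideanSpace ℝ (Fin 3)} (hx : x ∈ NonCoincident 3 4) :
    limitConnectedFour S' x = limitConnectedFour S x := by
  simp only [limitConnectedFour]
  rw [h4 hx, h2 (pair_mem_of_mem_four hx (i := 0) (j := 1) (by decide)),
    h2 (pair_mem_of_mem_four hx (i := 2) (j := 3) (by decide)),
    h2 (pair_mem_of_mem_four hx (i := 0) (j := 2) (by decide)),
    h2 (pair_mem_of_mem_four hx (i := 1) (j := 3) (by decide)),
    h2 (pair_mem_of_mem_four hx (i := 0) (j := 3) (by decide)),
    h2 (pair_mem_of_mem_four hx (i := 1) (j := 2) (by decide))]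

/-- `HasNontrivialU4` is decided on non-coincident configurations. -/
theorem hasNontrivialU4_iff_of_eqOn {S S' : CorrFamily 3}
    (h : ∀ n, (NonCoincident 3 n).EqOn (S' n) (S n)) : HasNontrivialU4 S' ↔ HasNontrivialU4 S := by
  constructor
  · rintro ⟨x, hx, hne⟩
    exact ⟨x, hx, by rwa [limitConnectedFour_congr (h 2) (h 4) hx] at hne⟩
  · rintro ⟨x, hx, hne⟩
    exact ⟨x, hx, by rwa [← limitConnectedFour_congr (h 2) (h 4) hx] at hne⟩

/-- Scale covariance on `NonCoincident` of `S` becomes full `IsScaleCovariant` of its normalisation. -/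
theorem isScaleCovariant_of_normalised {S S' : CorrFamily 3} {Δ : ℝ}
    (heqOn : ∀ n, (NonCoincident 3 n).EqOn (S' n) (S n))
    (hzero : ∀ n z, z ∉ NonCoincident 3 n → S' n z = 0)
    (hcov : ScaleCovariantOn Δ S) :
    IsScaleCovariant Δ S' := by
  intro n c hc z
  by_cases hz : Function.Injective z
  · have hzm : z ∈ NonCoincident 3 n := hz
    have hz' : (fun i => c • z i) ∈ NonCoincident 3 n := smul_mem_nonCoincident hc.ne' hzm
    rw [heqOn n hz', heqOn n hzm]
    exact hcov n c hc z hzm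
  · have hz' : (fun i => c • z i) ∉ NonCoincident 3 n := fun h =>
      hz ((smul_right_injective (EuclideanSpace ℝ (Fin 3)) hc.ne').of_comp_iff z |>.1 h)
    rw [hzero n _ hz', hzero n z hz, mul_zero]

/-- The normalisation package of item 4739, with the clauses this line consumes made explicit:
`S'` agrees with `S` on `NonCoincident`, inherits the index, and is fully scale covariant. -/
theorem normalise (hN : Summit.CriticalPhenomena.Ising3DConformalLimit.Theses.WeylWindow.LimitNormalisation)
    {ρ : ℝ → ℝ} {S : CorrFamily 3} {Δ : ℝ} (h : IsLimitWithIndex ρ S Δ) (hcov : ScaleCovariantOn Δ S) :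
    ∃ S' : CorrFamily 3, IsLimitWithIndex ρ S' Δ ∧ (∀ n, (NonCoincident 3 n).EqOn (S' n) (S n)) ∧
      (∀ n z, z ∉ NonCoincident 3 n → S' n z = 0) ∧ IsTranslationInvariant S' ∧
      IsScaleCovariant Δ S' ∧ (∀ n, ContinuousOn (S' n) (NonCoincident 3 n)) := by
  obtain ⟨hρ, hlim, hnd, hidx⟩ := h
  obtain ⟨S', hlim', hzero, hnd', hTI, hcont⟩ := hN ρ S hρ hlim hnd
  have heqOn : ∀ n, (NonCoincident 3 n).EqOn (S' n) (S n) := eqOn_of_limits hlim hlim'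
  exact ⟨S', ⟨hρ, hlim', hnd', hidx⟩, heqOn, hzero, hTI,
    isScaleCovariant_of_normalised heqOn hzero hcov, hcont⟩

/-! ### §4. The kernel-checked composition -/

/-- **The line's implication** (sorry-free): Lamperti fixes `Δ ∈ [1/2,1]` and the index; `η = 2Δ - 1`
exists, so `Δ ≤ 3/4` by Duminil-Copin–Panis Thm 1.5 (tree theorem `dcp_isingEta_le_half_holds`); below
`3/4` the current branch concludes; AT `3/4` the limit is normalised (item 4739) and the marginal
exclusion concludes for `S'`, hence for `S`. -/
theorem crux_of_statements :
    Lamperti → EtaExists →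
    Summit.CriticalPhenomena.Ising3DConformalLimit.Theses.WeylWindow.LimitNormalisation →
    CurrentBranch → MarginalExclusion → Crux := by
  intro hL hE hN hC hM ρ S hρ hlim hnd
  obtain ⟨Δ, h12, -, hidx, hcov⟩ := hL ρ S hρ hlim hnd
  have hWI : IsLimitWithIndex ρ S Δ := ⟨hρ, hlim, hnd, hidx⟩
  have hη : HasIsingExponentEta 3 (2 * Δ - 1) := hE ρ S Δ hWI
  have h34 : Δ ≤ 3/4 := by
    have := dcp_isingEta_le_half_holds (2 * Δ - 1) hη
    linarith
  rcases lt_or_eq_of_le h34 with hlt | heq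
  · exact hC ρ S Δ hWI hcov h12 hlt
  · subst heq
    obtain ⟨S', hWI', heqOn, hzero, hTI, hsc, hcont⟩ := normalise hN hWI hcov
    exact (hasNontrivialU4_iff_of_eqOn heqOn).1 (hM ρ S' hWI' hzero hTI hsc hcont)

/-- **REGISTERED COMPOSITION — the line closes the crux.** Its only hypothesis is the registered
obligation `WeylWindow.LimitNormalisation` (item stmt-CriticalPhenomena-4739, by name); the four declared
stubs are applied inside; the conclusion is the crux decl BY NAME. -/
theorem IsingEuclidUpgradeR4NonGaussian_of
    (hN : Summit.CriticalPhenomena.Ising3DConformalLimit.Theses.WeylWindow.LimitNormalisation) :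
    Summit.CriticalPhenomena.Ising3DConformalLimit.Theses.HyperoctahedralRP.IsingEuclidUpgradeR4NonGaussian :=
  crux_of_statements stub_lamperti stub_etaExists hN currentBranch_of_stubs stub_marginalExclusion

/-- **REGISTERED COMPOSITION, item-route copy**: the same composition concluding the item's own route decl
`IsingEuclidUpgrade.IsingEuclidUpgradeR4NonGaussian` (the copies are one `Prop`, `crux_iff_isingEuclidUpgrade`). -/
theorem IsingEuclidUpgradeR4NonGaussian_of_isingEuclidUpgrade
    (hN : Summit.CriticalPhenomena.Ising3DConformalLimit.Theses.WeylWindow.LimitNormalisation) :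
    Summit.CriticalPhenomena.Ising3DConformalLimit.Theses.IsingEuclidUpgrade.IsingEuclidUpgradeR4NonGaussian :=
  IsingEuclidUpgradeR4NonGaussian_of hN

/-! ### §5. Calibration (sorry-free): the branch stubs are WEAKENINGS of the crux, the marginal stub
follows from either of two existing items, and the card's original `Δ = 1/2 ∨ Δ > 1/2` split also
closes the crux. -/

/-- The three branch statements are consequences of the crux (no stub is stronger than the crux). -/
theorem branches_of_crux (h : Crux) : CurrentBranch ∧ MarginalExclusion ∧ MeanFieldBranch :=
  ⟨fun ρ S _ hWI _ _ _ => h ρ S hWI.1 hWI.2.1 hWI.2.2.1,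
    fun ρ S hWI _ _ _ _ => h ρ S hWI.1 hWI.2.1 hWI.2.2.1,
    fun ρ S hWI _ => h ρ S hWI.1 hWI.2.1 hWI.2.2.1⟩

/-- **(a)** item stmt-2601 closes the marginal branch: a Gaussian limit has `Δ = 1/2 ≠ 3/4`. -/
theorem marginalExclusion_of_gaussianLimitIsFree
    (hGF : Summit.CriticalPhenomena.Ising3DConformalLimit.Theses.AnomalousForcesInteraction.GaussianLimitIsFree) :
    MarginalExclusion := by
  intro ρ S hWI _ hTI hsc _
  by_contra hU
  have h := hGF ρ (3/4) S hWI.1 hWI.2.1 hWI.2.2.1 hTI hsc hU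
  norm_num at h

/-- **The card's original dispatch** (`Δ = 1/2` mean-field branch ∨ `Δ > 1/2` anomalous branch, the
latter = item 2601 fed through item 4739): also a complete cover, WITHOUT `EtaExists`. -/
theorem of_meanFieldBranch :
    Lamperti →
    Summit.CriticalPhenomena.Ising3DConformalLimit.Theses.WeylWindow.LimitNormalisation →
    MeanFieldBranch →
    Summit.CriticalPhenomena.Ising3DConformalLimit.Theses.AnomalousForcesInteraction.GaussianLimitIsFree →
    Crux := by
  intro hL hN hMF hGF ρ S hρ hlim hnd
  obtain ⟨Δ, h12, -, hidx, hcov⟩ := hL ρ S hρ hlim hnd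
  have hWI : IsLimitWithIndex ρ S Δ := ⟨hρ, hlim, hnd, hidx⟩
  rcases eq_or_lt_of_le h12 with heq | hgt
  · subst heq
    exact hMF ρ S hWI hcov
  · by_contra hU
    obtain ⟨S', hWI', heqOn, -, hTI, hsc, -⟩ := normalise hN hWI hcov
    have hU' : ¬ HasNontrivialU4 S' := fun h => hU ((hasNontrivialU4_iff_of_eqOn heqOn).1 h)
    have h := hGF ρ Δ S' hWI'.1 hWI'.2.1 hWI'.2.2.1 hTI hsc hU'
    linarith

/-! ### §5b. Item stmt-5507 (`WindowBelowHalf`, `η_eff < 1/2` between axis scales) also closes the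
marginal branch: it is INCONSISTENT with a limit of dimension `3/4`, so `MarginalExclusion` holds
vacuously under it. -/

/-- The reference pair `(0, e₀)`. -/
def refPair : Fin 2 → EuclideanSpace ℝ (Fin 3) := ![0, EuclideanSpace.single (0 : Fin 3) (1:ℝ)]

theorem refPair_mem : refPair ∈ NonCoincident 3 2 := by
  refine pair_mem_nonCoincident fun h => ?_
  have := congrArg (fun v : EuclideanSpace ℝ (Fin 3) => v 0) h
  simp at this

/-- At mesh `1/m` the scaled reference pair `k•(0,e₀)` sits exactly on the lattice points
`(0, (k m)·e₁)`. -/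
theorem latticeApprox_smul_refPair (k m : ℕ) (hm : 0 < m) :
    (fun i => latticeApprox (1 / (m:ℝ)) ((k:ℝ) • refPair i)) =
      ![(0 : Site 3), Pi.single 0 ((k * m : ℕ) : ℤ)] := by
  have hm' : (0:ℝ) < m := by exact_mod_cast hm
  funext i j
  fin_cases i
  · simp [refPair, latticeApprox_apply]
  · simp only [refPair, latticeApprox_apply, Fin.mk_one, Matrix.cons_val_one, Matrix.cons_val_zero,
      PiLp.smul_apply, PiLp.single_apply, smul_eq_mul, Pi.single_apply]
    by_cases hj : j = 0
    · subst hj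
      simp only [if_true, mul_one]
      rw [show (k:ℝ) / (1 / (m:ℝ)) = ((k * m : ℕ) : ℤ) by push_cast; field_simp]
      exact Int.floor_intCast _
    · simp [hj]

/-- **(b)** item stmt-5507 closes the marginal branch (vacuously: the window below `1/2` forbids a
limit of dimension `3/4`). With `a := S₂(0,e₀) > 0`, the convergence at the pairs `k•(0,e₀)` along
the meshes `1/m` reads `ρ(1/m)²⟨σ₀σ_{kme₁}⟩ → k^{-3/2} a` (scale covariance), while `WindowBelowHalf`
gives `c·k^{-(3/2-ε)}·ρ(1/m)²⟨σ₀σ_{me₁}⟩ ≤ ρ(1/m)²⟨σ₀σ_{kme₁}⟩`; in the limit `c k^{ε} ≤ 1` for every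
`k ≥ 1`, absurd for `k` large. -/
theorem marginalExclusion_of_windowBelowHalf
    (hW : Summit.CriticalPhenomena.Ising3DConformalLimit.Theses.LatticeSDPCertificates.WindowBelowHalf) :
    MarginalExclusion := by
  intro ρ S hWI _ _ hsc _
  obtain ⟨hρ, hlim, hnd, -⟩ := hWI
  obtain ⟨ε, c, hε, hc, hwin⟩ := hW
  exfalso
  set a : ℝ := S 2 refPair with ha_def
  have ha : 0 < a := hnd _ refPair_mem
  -- the mesh sequence `δ_m = 1/m → 0⁺`
  have hδ : Tendsto (fun m : ℕ => (1:ℝ) / m) atTop (𝓝[>] (0:ℝ)) := by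
    refine tendsto_nhdsWithin_iff.2 ⟨tendsto_one_div_atTop_nhds_zero_nat, ?_⟩
    filter_upwards [eventually_ge_atTop 1] with m hm
    have hm' : (0:ℝ) < m := Nat.cast_pos.2 hm
    exact one_div_pos.2 hm'
  -- `T_k(m) := ρ(1/m)² ⟨σ₀σ_{kme₁}⟩ → k^{-2·(3/4)} a`
  have hT : ∀ k : ℕ, 0 < k →
      Tendsto (fun m : ℕ => ρ (1 / m) ^ 2 * criticalTwoPoint 3 (Pi.single 0 ((k * m : ℕ) : ℤ)))
        atTop (𝓝 ((k:ℝ) ^ (-((2:ℕ):ℝ) * (3/4)) * a)) := by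
    intro k hk
    have hk' : (0:ℝ) < k := by exact_mod_cast hk
    have hmem : (fun i => (k:ℝ) • refPair i) ∈ NonCoincident 3 2 :=
      smul_mem_nonCoincident hk'.ne' refPair_mem
    have h1 := ((hlim 2).tendsto_at hmem).comp hδ
    rw [hsc 2 k hk' refPair] at h1
    refine h1.congr' ?_
    filter_upwards [eventually_ge_atTop 1] with m hm
    simp only [Function.comp_apply, rescaledCorrelator_apply]
    rw [latticeApprox_smul_refPair k m hm, criticalCorr_two]
  -- the window inequality, multiplied by `ρ(1/m)²`
  have key : ∀ k : ℕ, 0 < k → c * (k:ℝ) ^ (-((3:ℝ) / 2 - ε)) * a ≤ (k:ℝ) ^ (-((2:ℕ):ℝ) * (3/4)) * a := by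
    intro k hk
    have hk' : (0:ℝ) < k := by exact_mod_cast hk
    have hlhs : Tendsto (fun m : ℕ => c * (k:ℝ) ^ (-((3:ℝ) / 2 - ε)) *
        (ρ (1 / m) ^ 2 * criticalTwoPoint 3 (Pi.single 0 (m : ℤ)))) atTop
        (𝓝 (c * (k:ℝ) ^ (-((3:ℝ) / 2 - ε)) * a)) := by
      have h := (hT 1 one_pos).const_mul (c * (k:ℝ) ^ (-((3:ℝ) / 2 - ε)))
      simp only [Nat.cast_one, Real.one_rpow, one_mul] at h
      exact h
    refine le_of_tendsto_of_tendsto hlhs (hT k hk) ?_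
    filter_upwards [eventually_ge_atTop 1] with m hm
    have hmR : (0:ℝ) < m := by exact_mod_cast hm
    have hw := hwin m (k * m) hm (Nat.le_mul_of_pos_left m hk)
    have hratio : ((k * m : ℕ) : ℝ) / m = k := by push_cast; field_simp
    rw [hratio] at hw
    have hρ2 : 0 ≤ ρ (1 / m) ^ 2 := sq_nonneg _
    have := mul_le_mul_of_nonneg_left hw hρ2
    calc c * (k:ℝ) ^ (-((3:ℝ) / 2 - ε)) * (ρ (1 / ↑m) ^ 2 * criticalTwoPoint 3 (Pi.single 0 (m:ℤ)))
        = ρ (1 / ↑m) ^ 2 * (c * (k:ℝ) ^ (-((3:ℝ) / 2 - ε)) * criticalTwoPoint 3 (Pi.single 0 (m:ℤ))) := by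
          ring
      _ ≤ ρ (1 / ↑m) ^ 2 * criticalTwoPoint 3 (Pi.single 0 ((k * m : ℕ) : ℤ)) := this
  -- `c k^ε ≤ 1` for all `k ≥ 1`
  have key' : ∀ k : ℕ, 0 < k → c * (k:ℝ) ^ ε ≤ 1 := by
    intro k hk
    have hk' : (0:ℝ) < k := by exact_mod_cast hk
    have h := key k hk
    have hexp : (k:ℝ) ^ (-((2:ℕ):ℝ) * (3/4)) = (k:ℝ) ^ (-((3:ℝ) / 2)) := by norm_num
    have hsplit : (k:ℝ) ^ (-((3:ℝ) / 2 - ε)) = (k:ℝ) ^ (-((3:ℝ) / 2)) * (k:ℝ) ^ ε := by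
      rw [← Real.rpow_add hk']; congr 1; ring
    rw [hexp, hsplit] at h
    have hpos : 0 < (k:ℝ) ^ (-((3:ℝ) / 2)) * a := mul_pos (Real.rpow_pos_of_pos hk' _) ha
    have h' : (c * (k:ℝ) ^ ε) * ((k:ℝ) ^ (-((3:ℝ) / 2)) * a) ≤ 1 * ((k:ℝ) ^ (-((3:ℝ) / 2)) * a) := by
      calc (c * (k:ℝ) ^ ε) * ((k:ℝ) ^ (-((3:ℝ) / 2)) * a)
          = c * ((k:ℝ) ^ (-((3:ℝ) / 2)) * (k:ℝ) ^ ε) * a := by ring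
        _ ≤ (k:ℝ) ^ (-((3:ℝ) / 2)) * a := h
        _ = 1 * ((k:ℝ) ^ (-((3:ℝ) / 2)) * a) := by ring
    exact le_of_mul_le_mul_right h' hpos
  -- choose `k` with `k^ε ≥ 2/c`
  set K : ℝ := (2 / c) ^ (1 / ε) with hK
  have hK0 : 0 ≤ K := Real.rpow_nonneg (by positivity) _
  set k : ℕ := ⌈K⌉₊ + 1 with hk_def
  have hk : 0 < k := Nat.succ_pos _
  have hKk : K ≤ k := by
    have : K ≤ ⌈K⌉₊ := Nat.le_ceil K
    have h2 : (⌈K⌉₊ : ℝ) ≤ k := by rw [hk_def]; push_cast; linarith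
    exact this.trans h2
  have hKε : K ^ ε = 2 / c := by
    rw [hK, ← Real.rpow_mul (by positivity)]
    rw [show (1 / ε) * ε = 1 by field_simp, Real.rpow_one]
  have hge : 2 / c ≤ (k:ℝ) ^ ε := hKε ▸ Real.rpow_le_rpow hK0 hKk hε.le
  have h2 : 2 ≤ c * (k:ℝ) ^ ε := by
    have := mul_le_mul_of_nonneg_left hge hc.le
    rwa [mul_div_cancel₀ _ hc.ne'] at this
  linarith [key' k hk]

/-! ### §D. DREFUTE APPENDIX (refuter-drefute-stmt-CriticalPhenomena-0636-0, 2026-08-16)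

Cheap attacks on the stub set of the line, kernel-checked:
* `Drefute.lamperti_holds` — **`stub_lamperti` is CLOSED from the tree** (`exists_rpow_scale_mem_Icc` for
  the window + covariance, `exists_rpow_scale_and_ratio` for the index, glued by uniqueness of the
  covariance exponent of a non-degenerate family). Candidate proof for the lead (a refuter does not land
  positive statements).
* MUTATION LEMMAS (which hypotheses of each stub are load-bearing; every witness is explicit):
  `lamperti_false_without_nondegeneracy` (ρ δ = δ, zero family: index `+1`, outside the window),
  `etaExists_false_without_limit` (`δ^{-1/2}` and `δ^{-5/8}` both have indices in the window; `η` cannot be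
  both `0` and `1/4`), `etaExists_false_without_nondegeneracy` (ρ = δ, δ²: zero family twice),
  `currentBranch_false_without_latticeClause` / `meanFieldBranch_false_without_latticeClause`
  (generalised free field of dimension `13/25 ∈ [1/2,3/4)` resp. `1/2`: `U₄ ≡ 0`).
-/

namespace Drefute

/-- The covariance exponent of a non-degenerate family is unique (read at the pair `(0,e₀)`, scale `2`). -/
theorem scaleCovariantOn_exponent_unique {S : CorrFamily 3} {Δ₁ Δ₂ : ℝ}
    (hnd : IsNondegenerateTwoPoint S) (h₁ : ScaleCovariantOn Δ₁ S) (h₂ : ScaleCovariantOn Δ₂ S) :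
    Δ₁ = Δ₂ := by
  have ha : 0 < S 2 refPair := hnd _ refPair_mem
  have e₁ := h₁ 2 2 two_pos refPair refPair_mem
  have e₂ := h₂ 2 2 two_pos refPair refPair_mem
  rw [e₁] at e₂
  have h := mul_right_cancel₀ ha.ne' e₂
  have hl : 0 < Real.log 2 := Real.log_pos one_lt_two
  have h' := congrArg Real.log h
  rw [Real.log_rpow two_pos, Real.log_rpow two_pos] at h'
  have h'' := mul_right_cancel₀ hl.ne' h'
  push_cast at h''
  linarith

/-- The regular-variation index of a renormalisation is unique (`𝓝[>] 0` is non-trivial). -/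
theorem hasIndex_unique {ρ : ℝ → ℝ} {Δ₁ Δ₂ : ℝ} (h₁ : HasIndex ρ Δ₁) (h₂ : HasIndex ρ Δ₂) :
    Δ₁ = Δ₂ := by
  have h := tendsto_nhds_unique (h₁ 2 two_pos) (h₂ 2 two_pos)
  have h' := congrArg Real.log h
  rw [Real.log_rpow two_pos, Real.log_rpow two_pos] at h'
  have hl : 0 < Real.log 2 := Real.log_pos one_lt_two
  have := mul_right_cancel₀ hl.ne' h'
  linarith

/-- **`stub_lamperti` closed from the tree** (sorry-free candidate proof). -/
theorem lamperti_holds : Lamperti := by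
  intro ρ S hρ hlim hnd
  obtain ⟨Δ₁, hΔ₁, hcov₁⟩ := hlim.exists_rpow_scale_mem_Icc hρ hnd
  obtain ⟨Δ₂, -, hcov₂, hratio⟩ := hlim.exists_rpow_scale_and_ratio (by norm_num) hρ hnd
  have heq : Δ₁ = Δ₂ := scaleCovariantOn_exponent_unique hnd hcov₁ hcov₂
  subst heq
  exact ⟨Δ₁, hΔ₁.1, hΔ₁.2, hratio, hcov₁⟩

/-! #### Mutation lemmas -/

/-- `Lamperti` with `IsNondegenerateTwoPoint` dropped. -/
def LampertiWithoutNondegeneracy : Prop :=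
  ∀ (ρ : ℝ → ℝ) (S : CorrFamily 3), (∀ δ ∈ Set.Ioc (0:ℝ) 1, 0 < ρ δ) →
    HasPointwiseScalingLimit (criticalCorr 3) ρ S →
    ∃ Δ : ℝ, 1/2 ≤ Δ ∧ Δ ≤ 1 ∧ HasIndex ρ Δ ∧ ScaleCovariantOn Δ S

/-- The zero family (value `criticalCorr 3 0 _` at `n = 0`); as in Disproof §A.1 (workfile not importable). -/
def zeroFamily : CorrFamily 3 := fun n _ => if n = 0 then criticalCorr 3 0 (fun _ => 0) else 0

/-- Any renormalisation with `|ρ δ| ≤ δ` on `(0,1)` sends `criticalCorr 3` to the zero family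
(`|⟨∏σ⟩| ≤ 1`). [folklore] -/
theorem hasPointwiseScalingLimit_zeroFamily {ρ : ℝ → ℝ} (hρ : ∀ δ ∈ Set.Ioo (0:ℝ) 1, |ρ δ| ≤ δ) :
    HasPointwiseScalingLimit (criticalCorr 3) ρ zeroFamily := by
  intro n
  rcases Nat.eq_zero_or_pos n with rfl | hn
  · refine TendstoUniformlyOn.tendstoLocallyUniformlyOn (Metric.tendstoUniformlyOn_iff.2 ?_)
    intro ε hε
    refine Filter.Eventually.of_forall fun δ x _ => ?_
    have hx : (fun i : Fin 0 => latticeApprox δ (x i)) = fun _ => (0 : Site 3) :=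
      funext fun i => i.elim0
    rw [rescaledCorrelator_apply, hx]
    simp [zeroFamily, hε]
  · refine TendstoUniformlyOn.tendstoLocallyUniformlyOn (Metric.tendstoUniformlyOn_iff.2 ?_)
    intro ε hε
    have hm : Set.Ioo (0:ℝ) (min 1 ε) ∈ 𝓝[>] (0:ℝ) := Ioo_mem_nhdsGT (lt_min one_pos hε)
    filter_upwards [hm] with δ hδ x _
    have hn0 : n ≠ 0 := hn.ne'
    have hδ1 : δ < 1 := hδ.2.trans_le (min_le_left _ _)
    have hδε : δ < ε := hδ.2.trans_le (min_le_right _ _)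
    have hρδ : |ρ δ| ≤ δ := hρ δ ⟨hδ.1, hδ1⟩
    simp only [zeroFamily, if_neg hn0, rescaledCorrelator_apply, Real.dist_eq, zero_sub, abs_neg, abs_mul,
      abs_pow]
    have h1 : |criticalCorr 3 n fun i => latticeApprox δ (x i)| ≤ 1 := abs_criticalCorr_le_one le_rfl _ _
    calc |ρ δ| ^ n * |criticalCorr 3 n fun i => latticeApprox δ (x i)| ≤ δ ^ n * 1 :=
          mul_le_mul (pow_le_pow_left₀ (abs_nonneg _) hρδ n) h1 (abs_nonneg _) (pow_nonneg hδ.1.le n)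
      _ ≤ δ ^ 1 * 1 :=
          mul_le_mul_of_nonneg_right (pow_le_pow_of_le_one hδ.1.le hδ1.le hn) zero_le_one
      _ < ε := by simpa using hδε

/-- Pure powers have an index: `HasIndex (δ ↦ δ^k) (-k)`. -/
theorem hasIndex_pow (k : ℕ) : HasIndex (fun δ => δ ^ k) (-(k:ℝ)) := by
  intro c hc
  have : (fun _ : ℝ => c ^ (-(-(k:ℝ)))) =ᶠ[𝓝[>] (0:ℝ)] fun δ : ℝ => (c * δ) ^ k / δ ^ k := by
    filter_upwards [self_mem_nhdsWithin] with δ hδ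
    have hδ' : (0:ℝ) < δ := hδ
    rw [mul_pow, mul_div_assoc, div_self (pow_pos hδ' k).ne', mul_one, neg_neg, Real.rpow_natCast]
  exact tendsto_const_nhds.congr' this

/-- Pure real powers have an index: `HasIndex (δ ↦ δ^{-Δ}) Δ`. -/
theorem hasIndex_rpow (Δ : ℝ) : HasIndex (fun δ => δ ^ (-Δ)) Δ := by
  intro c hc
  have : (fun _ : ℝ => c ^ (-Δ)) =ᶠ[𝓝[>] (0:ℝ)] fun δ : ℝ => (c * δ) ^ (-Δ) / δ ^ (-Δ) := by
    filter_upwards [self_mem_nhdsWithin] with δ hδ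
    have hδ' : (0:ℝ) < δ := hδ
    rw [Real.mul_rpow hc.le hδ'.le, mul_div_assoc, div_self (Real.rpow_pos_of_pos hδ' _).ne', mul_one]
  exact tendsto_const_nhds.congr' this

/-- **M1 — `Lamperti` needs `IsNondegenerateTwoPoint`**: `ρ δ = δ` renormalises `criticalCorr 3` to the
zero family and has index `-1 ∉ [1/2,1]`; indices are unique. [folklore] -/
theorem lamperti_false_without_nondegeneracy : ¬ LampertiWithoutNondegeneracy := by
  intro h
  obtain ⟨Δ, h12, -, hidx, -⟩ := h (fun δ => δ ^ 1) zeroFamily (fun δ hδ => pow_pos hδ.1 1)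
    (hasPointwiseScalingLimit_zeroFamily fun δ hδ => by rw [pow_one, abs_of_pos hδ.1])
  have := hasIndex_unique hidx (hasIndex_pow 1)
  push_cast at this
  linarith

/-- `EtaExists` with the limit clause dropped (only positivity of `ρ` and an index). -/
def EtaExistsWithoutLimit : Prop :=
  ∀ (ρ : ℝ → ℝ) (Δ : ℝ), (∀ δ ∈ Set.Ioc (0:ℝ) 1, 0 < ρ δ) → HasIndex ρ Δ →
    HasIsingExponentEta 3 (2 * Δ - 1)

/-- **M2 — `EtaExists` needs the limit `S`**: `δ^{-1/2}` and `δ^{-5/8}` are admissible renormalisations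
with indices in the Ising window, but `η(ℤ³)` cannot be both `0` and `1/4` (`cofinite` on `ℤ³` is
non-trivial). [folklore] -/
theorem etaExists_false_without_limit : ¬ EtaExistsWithoutLimit := by
  intro h
  have h₁ := h (fun δ => δ ^ (-(1/2:ℝ))) (1/2) (fun δ hδ => Real.rpow_pos_of_pos hδ.1 _)
    (hasIndex_rpow _)
  have h₂ := h (fun δ => δ ^ (-(5/8:ℝ))) (5/8) (fun δ hδ => Real.rpow_pos_of_pos hδ.1 _)
    (hasIndex_rpow _)
  unfold HasIsingExponentEta HasSpatialDecayExponent at h₁ h₂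
  have := tendsto_nhds_unique h₁ h₂
  norm_num at this

/-- `EtaExists` with `IsNondegenerateTwoPoint` dropped. -/
def EtaExistsWithoutNondegeneracy : Prop :=
  ∀ (ρ : ℝ → ℝ) (S : CorrFamily 3) (Δ : ℝ), (∀ δ ∈ Set.Ioc (0:ℝ) 1, 0 < ρ δ) →
    HasPointwiseScalingLimit (criticalCorr 3) ρ S → HasIndex ρ Δ → HasIsingExponentEta 3 (2 * Δ - 1)

/-- **M2′ — `EtaExists` needs `S₂ > 0`**: `ρ = δ` and `ρ = δ²` are both limits (to the zero family)
with indices `-1`, `-2`, and `η` cannot be both `-3` and `-5`. [folklore] -/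
theorem etaExists_false_without_nondegeneracy : ¬ EtaExistsWithoutNondegeneracy := by
  intro h
  have h₁ := h (fun δ => δ ^ 1) zeroFamily (-((1:ℕ):ℝ)) (fun δ hδ => pow_pos hδ.1 1)
    (hasPointwiseScalingLimit_zeroFamily fun δ hδ => by rw [pow_one, abs_of_pos hδ.1]) (hasIndex_pow 1)
  have h₂ := h (fun δ => δ ^ 2) zeroFamily (-((2:ℕ):ℝ)) (fun δ hδ => pow_pos hδ.1 2)
    (hasPointwiseScalingLimit_zeroFamily fun δ hδ => by
      rw [abs_of_pos (pow_pos hδ.1 2)]; nlinarith [hδ.1, hδ.2]) (hasIndex_pow 2)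
  unfold HasIsingExponentEta HasSpatialDecayExponent at h₁ h₂
  have := tendsto_nhds_unique h₁ h₂
  push_cast at this
  norm_num at this

/-- `CurrentBranch` with the lattice clause dropped (model-blind, inside the branch window). -/
def CurrentBranchWithoutLatticeClause : Prop :=
  ∀ (S : CorrFamily 3) (Δ : ℝ), IsNondegenerateTwoPoint S → ScaleCovariantOn Δ S →
    1/2 ≤ Δ → Δ < 3/4 → HasNontrivialU4 S

/-- **M3 — `CurrentBranch` needs the lattice clause**: the generalised free field of dimension
`13/25 ∈ [1/2, 3/4)` is non-degenerate, scale covariant, and has `U₄ ≡ 0` (tree file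
`GeneralisedFreeFamily`). [cite: FrancescoMathieuSenechal1997, §4.3.1] -/
theorem currentBranch_false_without_latticeClause : ¬ CurrentBranchWithoutLatticeClause := fun h =>
  not_hasNontrivialU4_gff (13/25)
    (h (gffFamily (13/25)) (13/25) (isNondegenerateTwoPoint_gff _)
      (fun n c hc x _ => isScaleCovariant_gff (13/25) n c hc x) (by norm_num) (by norm_num))

/-- **M3′ — the card's `MeanFieldBranch` needs the lattice clause too** (GFF of dimension `1/2`,
the massless free field itself). [cite: FrancescoMathieuSenechal1997, §4.3.1] -/
theorem meanFieldBranch_false_without_latticeClause :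
    ¬ ∀ (S : CorrFamily 3), IsNondegenerateTwoPoint S → ScaleCovariantOn (1/2) S → HasNontrivialU4 S :=
  fun h => not_hasNontrivialU4_gff (1/2)
    (h _ (isNondegenerateTwoPoint_gff _) (fun n c hc x _ => isScaleCovariant_gff _ n c hc x))


/-! #### Helper lemmas for `stub_etaExists` (positive side-products; checked) -/

/-- Step (2a) of the `EtaExists` route: along the dyadic meshes `δ_k = 2^{-k}` the index gives
`log ρ(2^{-(k+1)}) - log ρ(2^{-k}) → Δ log 2`. [folklore] -/
theorem tendsto_log_ratio_of_hasIndex {ρ : ℝ → ℝ} {Δ : ℝ} (hρ : ∀ δ ∈ Set.Ioc (0:ℝ) 1, 0 < ρ δ)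
    (h : HasIndex ρ Δ) :
    Tendsto (fun k : ℕ => Real.log (ρ ((1/2:ℝ) ^ (k + 1))) - Real.log (ρ ((1/2:ℝ) ^ k))) atTop
      (𝓝 (Δ * Real.log 2)) := by
  have hc : Tendsto (fun δ => ρ (1/2 * δ) / ρ δ) (𝓝[>] 0) (𝓝 ((1/2:ℝ) ^ (-Δ))) := h (1/2) (by norm_num)
  have hδ : Tendsto (fun k : ℕ => (1/2:ℝ) ^ k) atTop (𝓝[>] 0) := by
    refine tendsto_nhdsWithin_iff.2 ⟨tendsto_pow_atTop_nhds_zero_of_lt_one (by norm_num) (by norm_num), ?_⟩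
    exact Filter.Eventually.of_forall fun k => Set.mem_Ioi.2 (pow_pos (by norm_num : (0:ℝ) < 1/2) k)
  have hpos : 0 < (1/2:ℝ) ^ (-Δ) := Real.rpow_pos_of_pos (by norm_num) _
  have h2 := ((Real.continuousAt_log hpos.ne').tendsto.comp (hc.comp hδ))
  have hlog : Real.log ((1/2:ℝ) ^ (-Δ)) = Δ * Real.log 2 := by
    rw [Real.log_rpow (by norm_num), one_div, Real.log_inv]; ring
  rw [hlog] at h2
  refine h2.congr fun k => ?_
  have hk : (1/2:ℝ) ^ k ∈ Set.Ioc (0:ℝ) 1 :=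
    ⟨pow_pos (by norm_num) k, pow_le_one₀ (by norm_num) (by norm_num)⟩
  have hk1 : (1/2:ℝ) ^ (k + 1) ∈ Set.Ioc (0:ℝ) 1 :=
    ⟨pow_pos (by norm_num) _, pow_le_one₀ (by norm_num) (by norm_num)⟩
  simp only [Function.comp_apply]
  rw [show (1/2:ℝ) * (1/2:ℝ) ^ k = (1/2:ℝ) ^ (k + 1) by ring,
    Real.log_div (hρ _ hk1).ne' (hρ _ hk).ne']

/-- Step (2b): Cesàro — `log ρ(2^{-k}) / k → Δ log 2` (no measurability of `ρ` is needed). [folklore] -/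
theorem tendsto_log_renorm_div_of_hasIndex {ρ : ℝ → ℝ} {Δ : ℝ} (hρ : ∀ δ ∈ Set.Ioc (0:ℝ) 1, 0 < ρ δ)
    (h : HasIndex ρ Δ) :
    Tendsto (fun k : ℕ => Real.log (ρ ((1/2:ℝ) ^ k)) / k) atTop (𝓝 (Δ * Real.log 2)) := by
  have hu := (tendsto_log_ratio_of_hasIndex hρ h).cesaro
  have h0 : Tendsto (fun n : ℕ => Real.log (ρ ((1/2:ℝ) ^ 0)) / (n:ℝ)) atTop (𝓝 0) :=
    tendsto_const_div_atTop_nhds_zero_nat _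
  have hsum := hu.add h0
  rw [add_zero] at hsum
  refine hsum.congr' ?_
  filter_upwards [eventually_gt_atTop 0] with n hn
  rw [Finset.sum_range_sub (fun k => Real.log (ρ ((1/2:ℝ) ^ k))) n]
  have hn' : (n:ℝ) ≠ 0 := by exact_mod_cast hn.ne'
  field_simp
  ring

/-- Step (1a): at mesh `1/m` the reference pair sits exactly on `(0, m·e₁)`. [folklore] -/
theorem latticeApprox_refPair (m : ℕ) (hm : 0 < m) :
    (fun i => latticeApprox (1 / (m:ℝ)) (refPair i)) = ![(0 : Site 3), Pi.single 0 (m : ℤ)] := by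
  have h := latticeApprox_smul_refPair 1 m hm
  simp only [Nat.cast_one, one_smul, one_mul] at h
  exact h

/-- Step (1b): the axis values `a_m = ρ(1/m)² ⟨σ₀σ_{m e₁}⟩_{β_c}` converge to `S₂(0,e₀)` along ALL `m`. [folklore] -/
theorem tendsto_axis_of_limit {ρ : ℝ → ℝ} {S : CorrFamily 3}
    (hlim : HasPointwiseScalingLimit (criticalCorr 3) ρ S) :
    Tendsto (fun m : ℕ => ρ (1 / m) ^ 2 * criticalTwoPoint 3 (Pi.single 0 (m : ℤ))) atTop
      (𝓝 (S 2 refPair)) := by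
  have hδ : Tendsto (fun m : ℕ => (1:ℝ) / m) atTop (𝓝[>] (0:ℝ)) := by
    refine tendsto_nhdsWithin_iff.2 ⟨tendsto_one_div_atTop_nhds_zero_nat, ?_⟩
    filter_upwards [eventually_ge_atTop 1] with m hm
    have hm' : (0:ℝ) < m := Nat.cast_pos.2 hm
    exact one_div_pos.2 hm'
  have h1 := ((hlim 2).tendsto_at refPair_mem).comp hδ
  refine h1.congr' ?_
  filter_upwards [eventually_ge_atTop 1] with m hm
  simp only [Function.comp_apply, rescaledCorrelator_apply]
  rw [latticeApprox_refPair m hm, criticalCorr_two]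

/-- Step (3a): the axis two-point function is antitone (Messager–Miracle-Solé, tree theorem). [cite: MessagerMiracleSoleJSP1977, main theorem (monotonicity of ⟨σ₀σ_x⟩ under reflections)] -/
theorem axis_antitone : Antitone (fun m : ℕ => criticalTwoPoint 3 (Pi.single 0 (m : ℤ))) := by
  refine antitone_nat_of_succ_le fun m => ?_
  have h := messager_miracleSole_holds (d := 3) (β := criticalBeta 3) (criticalBeta_nonneg 3)
    (Pi.single 0 (m:ℤ)) 0 (by simp)
  have he : (Pi.single 0 (m:ℤ) + Pi.single 0 1 : Site 3) = Pi.single 0 ((m + 1 : ℕ) : ℤ) := by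
    rw [← Pi.single_add]; push_cast; rfl
  simpa only [criticalTwoPoint, he] using h

/-- Step (3b): the axis two-point function is positive (tree two-point lower bound). [folklore] -/
theorem axis_pos (m : ℕ) : 0 < criticalTwoPoint 3 (Pi.single 0 (m : ℤ)) := by
  by_cases h : (Pi.single 0 (m : ℤ) : Site 3) = 0
  · rw [h, criticalTwoPoint_zero']
    exact one_pos
  · obtain ⟨c, C, hc, hbd⟩ := criticalTwoPoint_bounds_holds (d := 3) (by norm_num)
    have hn : 0 < (‖(Pi.single 0 (m : ℤ) : Site 3)‖ : ℝ) := norm_pos_iff.2 h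
    exact lt_of_lt_of_le (mul_pos hc (Real.rpow_pos_of_pos hn _)) (hbd _ h).1

end Drefute

end Summit.CriticalPhenomena.Ising3DConformalLimit.Cruxes.IsingEuclidUpgradeR4NonGaussian.FreeCovarianceDeltaDichotomy

end
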